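import Summits.HodgeConjecture.HodgeConjecture.Theorems.F0P3bKTypeIntegrationGK
import Summits.HodgeConjecture.HodgeConjecture.Theorems.F0P3bU21Restriction
import Summits.HodgeConjecture.HodgeConjecture.Theorems.F0P3bLocalAPacketsDefs
import HarnessLib

/-!
# K2 ∕ E1b — THEOREMS-SIDE DEFS LEAF «K-type twist»: the central twist of a `𝔤𝔩(3, ℂ)`-module and Kovačević's `u`-basis formulas WITH central character

Cell hodgecm-mathlib, Track B «K2-LIT», engine E1b; crux item h413 = stmt-HodgeConjecture-24833; author K2E1b-plan (g0).
K2-lead RULING R3 (d) «DEFS BEFORE SIGS IS HARD»: the two predicates named by the tier-1 sockets of unit U0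
(`Cruxes/H413/Lines/K2_E1b_GKCohomologyU21_U0_TwistIntegration.lean`: `sig_K2E1bKovLieTwist`, `…DatumTwistActs`, `…KTypeTwistGK`, `…TwistAdmissible`,
`…TwistChiScalars`, `…TwistHermitian`, `…TwistIrreducible`, `…DatumCohUnitaryIrrep`) live HERE as a ★ leaf; bodies VERBATIM from that module's §0
(commit 582d99f9cfed), parent namespace `…Cruxes.H413.K2E1bGKCohomologyU21` (the socket module's ED. 2 imports this leaf and drops its local copies —
statement bytes equal).  `IsTwistOf ρ z σ`: `σ(X) = kovLie ρ X + z·tr(X)·1` on `𝔲(2,1)`; `ActsOnKTypesTwist S e ρ𝔤`: ★ `ActsOnKTypes` body + the central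
term `(e∕3)·tr(X)·u^k`.  Definitions only; no `sorry`, no axiom, no instance, no notation.
Sources: [Kovacevic2021] §3 Def. 1; [BorelWallach2000] 0 §2.5, VI §4 4.7–4.8; [Rogawski1990] §12.3 p. 177; [KnappVogan1995] Prop. 4.120.

HONEST LABEL: HC_CM is proved only modulo the 7 printed citations (2 remaining named inputs: hLiu418 = stmt-HodgeConjecture-24832,
h413 = stmt-HodgeConjecture-24833) until rung 0 closes; this file asserts nothing (definitions only).
-/

set_option autoImplicit false
set_option linter.dupNamespace false

noncomputable section

namespace Summit.HodgeConjecture.HodgeConjecture.Cruxes.H413.K2E1bGKCohomologyU21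

open Literature.NumberTheory.Automorphic
open Literature.RepresentationTheory.KonnoKonno2007 Literature.RepresentationTheory.KonnoKonno2007.RealDualPair
open Literature.RepresentationTheory.KonnoKonno2007.RealDualPair.UForm
open Summit.HodgeConjecture.HodgeConjecture.Cruxes.H413.F0P3bLocalAPacketsDefs
open Summit.HodgeConjecture.HodgeConjecture.Cruxes.H413.F0P3bU21Restriction
open Summit.HodgeConjecture.HodgeConjecture.Cruxes.H413.F0P3bKTypeIntegration (KIdx kvec kTypeRep ActsOnKTypes)

-- Mathlib idiom (as in `GKModules`, the `Upq*` files, the Kovačević topic): commutator bracket on `Module.End` ∕ matrices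
attribute [local instance 100] LieRing.ofAssociativeRing

/-! ## The two definitions (bodies VERBATIM = U0 socket module §0) -/

/-- **`σ` is the central twist of `ρ` by `z`**: `σ(X) = ρ(X|_{𝔤𝔩₃}) + z·tr(X)·1` for `X ∈ 𝔲(2,1)` — a Lie homomorphism because `tr` kills
brackets; for `z = e∕3` the centre `i·1` acts by `i·e` (★ `SU21Datum.ρfun_one`: `ρ(1) = 0`).
(Rogawski1990, §12.3 p. 177) (KnappVogan1995, Prop. 4.120) — a route-posited predicate of the engine line, not a result of the literature (hence untagged). -/
def IsTwistOf {V : Type} [AddCommGroup V] [Module ℂ V] (ρ : Matrix (Fin 3) (Fin 3) ℂ →ₗ⁅ℂ⁆ Module.End ℂ V) (z : ℂ)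
    (σ : G21.lie →ₗ⁅ℝ⁆ Module.End ℂ V) : Prop :=
  ∀ X : G21.lie, σ X = kovLie ρ X + (z * (X : Matrix (Fin 2 ⊕ Fin 1) (Fin 2 ⊕ Fin 1) ℂ).trace) • (1 : Module.End ℂ V)

/-- **Twisted `u`-basis formulas on `𝔨`** (★ `ActsOnKTypes` body VERBATIM, plus the central term `(e∕3)·tr(X)·u^k`): for block-diagonal
`X = diag(X₁₁, x₂₂) ∈ 𝔨`, `ρ𝔤(X) u^k = [Kovačević's H_α, H_β coefficients] u^k − x₀₁ (k−1)(n+1−k) u^{k−1} − x₁₀ u^{k+1} + (e∕3) tr(X) u^k`.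
(Kovacevic2021, §3 Def. 1) (BorelWallach2000, VI §4 4.7–4.8)
— a route-posited predicate of the engine line, not a result of the literature (hence untagged). -/
def ActsOnKTypesTwist (S : Set (ℤ × ℤ)) (e : ℤ) (ρ𝔤 : (uFormGroup (Fin 2) (Fin 1)).lie →ₗ⁅ℝ⁆ Module.End ℂ (KIdx S →₀ ℂ)) : Prop :=
  ∀ (X : (uFormGroup (Fin 2) (Fin 1)).compactLie) (n m k : ℤ), (n, m) ∈ S → 1 ≤ k → k ≤ n →
    ρ𝔤 (LieSubalgebra.inclusion (uFormGroup (Fin 2) (Fin 1)).compactLie_le_lie X) (kvec S n m k) =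
      ((2 * (X : Matrix (Fin 2 ⊕ Fin 1) (Fin 2 ⊕ Fin 1) ℂ) (Sum.inl 0) (Sum.inl 0)
            - (X : Matrix (Fin 2 ⊕ Fin 1) (Fin 2 ⊕ Fin 1) ℂ) (Sum.inl 1) (Sum.inl 1)
            - (X : Matrix (Fin 2 ⊕ Fin 1) (Fin 2 ⊕ Fin 1) ℂ) (Sum.inr 0) (Sum.inr 0)) / 3 * ((n : ℂ) + 1 - 2 * k)
        + ((X : Matrix (Fin 2 ⊕ Fin 1) (Fin 2 ⊕ Fin 1) ℂ) (Sum.inl 0) (Sum.inl 0)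
            + (X : Matrix (Fin 2 ⊕ Fin 1) (Fin 2 ⊕ Fin 1) ℂ) (Sum.inl 1) (Sum.inl 1)
            - 2 * (X : Matrix (Fin 2 ⊕ Fin 1) (Fin 2 ⊕ Fin 1) ℂ) (Sum.inr 0) (Sum.inr 0)) / 3 *
            (((m : ℂ) - n - 1 + 2 * k) / 2)) • kvec S n m k
      + (-((X : Matrix (Fin 2 ⊕ Fin 1) (Fin 2 ⊕ Fin 1) ℂ) (Sum.inl 0) (Sum.inl 1) *
          (((k : ℂ) - 1) * ((n : ℂ) + 1 - k)))) • kvec S n m (k - 1)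
      + (-(X : Matrix (Fin 2 ⊕ Fin 1) (Fin 2 ⊕ Fin 1) ℂ) (Sum.inl 1) (Sum.inl 0)) • kvec S n m (k + 1)
      + (((e : ℂ) / 3) * ((X : Matrix (Fin 2 ⊕ Fin 1) (Fin 2 ⊕ Fin 1) ℂ) (Sum.inl 0) (Sum.inl 0)
            + (X : Matrix (Fin 2 ⊕ Fin 1) (Fin 2 ⊕ Fin 1) ℂ) (Sum.inl 1) (Sum.inl 1)
            + (X : Matrix (Fin 2 ⊕ Fin 1) (Fin 2 ⊕ Fin 1) ℂ) (Sum.inr 0) (Sum.inr 0))) • kvec S n m k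


end Summit.HodgeConjecture.HodgeConjecture.Cruxes.H413.K2E1bGKCohomologyU21

end
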